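import Literature.AlgebraicGeometry.Motives.AbelianVarietyQuasiIdempotentImageDual
import Literature.AlgebraicGeometry.ComplexMultiplication.RationalTateActionEigenOfIntegral
import HarnessLib

/-!
# The RATIONAL action on the image of a quasi-idempotent endomorphism induced by an integral action commuting with it, and the
# eigen hand-over on dual rational Tate modules

Topic `AlgebraicGeometry/Motives`; namespace `Literature.AlgebraicGeometry.Motives.AbelianVariety`.  THEOREMS ONLY (no definition, no
named fact, no instance, no `sorry`).  Inputs, all landed: ★ `AbelianVarietyImageRestrict` (`imageAction f φ ψ hf : R →+* End (image f)`,
`toImage_imageAction`), ★ `AbelianVarietyQuasiIdempotentImageDual` (`exists_eq_dualMap_toImage_baseChange_of_mem_eigenspace`), ★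
`endAlgebra.of : End B →+* End⁰(B)`, ★ `rationalTateAction` / `rationalTateAction_of` (`TateModuleOfCMFreeRankOne`), ★
`RationalTateActionEigenOfIntegral` (`dualMap_rationalTateAction_baseChange_eq_smul_of_integral`), Mathlib `IsLocalization.lift`.

## What is proved

Let `u : X ⟶ X` be an endomorphism of an abelian variety with image `ū : X ↠ Im u`, and `ρ : R →+* End X` an INTEGRAL action of a
commutative ring `R` commuting with `u`.  Then:
* `imageAction u ρ ρ _ : R →+* End (Im u)` (★) is, element by element, the restriction `imageRestrict u (ρ r) (ρ r) _` (`imageAction_apply`,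
  `rfl`), so `ᵗV_ℓ ū ∘ ᵗV_ℓ(ρ|_{Im u} r) = ᵗV_ℓ(ρ r) ∘ ᵗV_ℓ ū` (`dualMap_toImage_comp_dualMap_imageAction`);
* if `M = Frac R` (`[IsFractionRing R M]`) and every non-zero-divisor `s ∈ R` acts INVERTIBLY in `End⁰(Im u)` (`hunit` — automatic when
  `ℚ ⊗ R` is a field, i.e. the CM situation), the integral action extends UNIQUELY to a rational action
  `i : M →+* End⁰(Im u)` with `i(r/1) = 1 ⊗ ρ|_{Im u}(r)` (`exists_ringHom_endAlgebra_image`; Mathlib `IsLocalization.lift`);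
* HAND-OVER (`exists_dualMap_toImage_and_rationalTateAction_eq_smul`): for any commutative `ℚ_ℓ`-algebra `R′`, character `e : M →+* R′`
  and class `G ∈ R′ ⊗ (V_ℓ X)^∨` in the `a`-eigenspace of `1 ⊗ ᵗV_ℓ u` (`a ≠ 0`) which is `e(r)`-eigen for every `1 ⊗ ᵗV_ℓ(ρ r)`, there is
  `F ∈ R′ ⊗ (V_ℓ Im u)^∨` with `(1 ⊗ ᵗV_ℓ ū) F = G` and `(1 ⊗ ᵗ(rationalTateAction (Im u) (i m))) F = e(m) • F` for ALL `m ∈ M` — the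
  `(φ, i, f)` input of ★ `Sec42Data.exists_heckeCharacter_towerRep_eq_inv_smul_of_ringHom'` (`Liu2021/AppendixC/EtaleH1TowerCMQuotient`).

DICTIONARY LINE (cell `hodgecm-mathlib`, crux `HLiu418` = stmt-HodgeConjecture-24832, d6 HOME card S2′ `stub_d6_cmIsotypicQuotient`): with
`X := C.A K`, `u := a·ε_lab` the integral isotypic projector (DH1/DH2), `ρ :=` the integral Hecke action restricted to the commutant data the
line chooses, `M := M_lab = Frac` of its image: S2′'s body is «isotypy + Hecke-eigen ⟹ this hand-over ⟹ ★ p739802′».  The file moves no book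
(HC_CM is proved only modulo the 7 printed citations until rung 0 closes).

## References
* [MumfordAV1970] D. Mumford, *Abelian Varieties* (1970), §19 Thm. 1 (p. 173), Thm. 3 (p. 176).
* [SerreTate1968] J.-P. Serre, J. Tate, *Good reduction of abelian varieties*, Ann. of Math. 88 (1968), §4.
* [Liu2021] Y. Liu, *Fourier–Jacobi cycles and arithmetic relative trace formula*, Camb. J. Math. 9 (2021), App. D §D.4 (FJcycle.tex l. 5626–5627).
-/

set_option autoImplicit false

noncomputable section

open CategoryTheory
open scoped TensorProduct nonZeroDivisors

universe u

namespace Literature.AlgebraicGeometry.Motives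

namespace AbelianVariety

variable {K : Type u} [Field K] (ℓ : ℕ) [Fact ℓ.Prime] {X : AbelianVariety K} {u : X ⟶ X}
variable {R : Type} [CommRing R] (ρ : R →+* End X) (hρ : ∀ r : R, End.asHom (ρ r) ≫ u = u ≫ End.asHom (ρ r))

/-! ## §1 The induced integral action on the image, element by element -/

/-- The induced action on `Im u` is, element by element, the restriction of `ρ r` (unfolding of ★ `imageAction`).
[cite: MumfordAV1970, §19 Thm. 1 (p. 173)] -/
theorem imageAction_apply (r : R) :
    imageAction u ρ ρ hρ r = imageRestrict u (End.asHom (ρ r)) (End.asHom (ρ r)) (hρ r) := rfl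

/-- **`ᵗV_ℓ ū` intertwines the induced action on `Im u` with `ρ` on `X`**: `ᵗV_ℓ ū ∘ ᵗV_ℓ(ρ|_{Im u} r) = ᵗV_ℓ(ρ r) ∘ ᵗV_ℓ ū`
(★ `toImage_imageAction`, dualised). [cite: MumfordAV1970, §19 Thm. 1 (p. 173) and Thm. 3 (p. 176)] -/
theorem dualMap_toImage_comp_dualMap_imageAction (r : R) :
    (rationalTateModuleMap ℓ (toImage u)).dualMap ∘ₗ (rationalTateModuleMap ℓ (End.asHom (imageAction u ρ ρ hρ r))).dualMap =
      (rationalTateModuleMap ℓ (End.asHom (ρ r))).dualMap ∘ₗ (rationalTateModuleMap ℓ (toImage u)).dualMap := by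
  rw [LinearMap.dualMap_comp_dualMap, LinearMap.dualMap_comp_dualMap, ← rationalTateModuleMap_comp,
    ← rationalTateModuleMap_comp, toImage_imageAction]

/-! ## §2 The rational action on the image -/

open scoped IsMulCommutative in
/-- **The integral action on `Im u` extends to a RATIONAL action of `M = Frac R` on `End⁰(Im u)`**, as soon as every
non-zero-divisor of `R` acts invertibly INSIDE the (commutative) `ℚ`-algebra `ℚ[ρ|_{Im u}(R)] ⊆ End⁰(Im u)` generated by the image —
the complex-multiplication situation, where that algebra is a number field and every non-zero element is a unit (Mathlib
`IsLocalization.lift` into the commutative subalgebra, `Algebra.isMulCommutative_adjoin`). [cite: MumfordAV1970, §19 Thm. 3 (p. 176)]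
[cite: SerreTate1968, §4 (proof of Thm. 5)] -/
theorem exists_ringHom_endAlgebra_image {M : Type} [Field M] [Algebra R M] [IsFractionRing R M]
    (hunit : ∀ s : R⁰, IsUnit (⟨endAlgebra.of (image u) (imageAction u ρ ρ hρ (s : R)),
      Algebra.subset_adjoin (Set.mem_range_self (s : R))⟩ :
        Algebra.adjoin ℚ (Set.range fun r : R => endAlgebra.of (image u) (imageAction u ρ ρ hρ r)))) :
    ∃ i : M →+* (image u).endAlgebra, ∀ r : R, i (algebraMap R M r) = endAlgebra.of (image u) (imageAction u ρ ρ hρ r) := by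
  -- the commutative subalgebra generated by the image, as the target of the localisation lift
  set S : Set (image u).endAlgebra := Set.range fun r : R => endAlgebra.of (image u) (imageAction u ρ ρ hρ r) with hS
  have hcomm : ∀ x ∈ S, ∀ y ∈ S, x * y = y * x := by
    rintro _ ⟨a, rfl⟩ _ ⟨b, rfl⟩
    rw [← map_mul, ← map_mul, ← map_mul, ← map_mul, mul_comm]
  haveI := Algebra.isMulCommutative_adjoin ℚ hcomm
  letI : CommRing (Algebra.adjoin ℚ S) := inferInstance
  let g : R →+* Algebra.adjoin ℚ S :=
    ((endAlgebra.of (image u)).comp (imageAction u ρ ρ hρ)).codRestrict (Algebra.adjoin ℚ S)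
      fun r => Algebra.subset_adjoin (Set.mem_range_self r)
  have hg : ∀ s : R⁰, IsUnit (g s) := hunit
  refine ⟨((Algebra.adjoin ℚ S).val : Algebra.adjoin ℚ S →+* (image u).endAlgebra).comp
    (IsLocalization.lift (M := R⁰) (S := M) hg), fun r => ?_⟩
  rw [RingHom.comp_apply, IsLocalization.lift_eq]
  rfl

/-! ## §3 The eigen hand-over to the rational action on the image -/

/-- **Hand-over to the rational action on the image** (see the module docstring): an `a`-eigen class of `1 ⊗ ᵗV_ℓ u` (`a ≠ 0`) that is
`e(r)`-eigen for every `1 ⊗ ᵗV_ℓ(ρ r)` descends along `ū` to a class on `Im u` that is `e(m)`-eigen for the whole rational action `i(m)`,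
`m ∈ M = Frac R` (★ `exists_eq_dualMap_toImage_baseChange_of_mem_eigenspace` + `imageAction_apply` + ★
`dualMap_rationalTateAction_baseChange_eq_smul_of_integral`). [cite: MumfordAV1970, §19 Thm. 1 (p. 173) and Thm. 3 (p. 176)]
[cite: Liu2021, App. D §D.4 (FJcycle.tex l. 5626–5627)] -/
theorem exists_dualMap_toImage_and_rationalTateAction_eq_smul {a : ℕ} (ha : a ≠ 0) {M : Type} [Field M] [Algebra R M]
    [IsFractionRing R M] (i : M →+* (image u).endAlgebra)
    (hi : ∀ r : R, i (algebraMap R M r) = endAlgebra.of (image u) (imageAction u ρ ρ hρ r))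
    (R' : Type) [CommRing R'] [Algebra ℚ_[ℓ] R'] (e : M →+* R') (G : R' ⊗[ℚ_[ℓ]] Module.Dual ℚ_[ℓ] (X.rationalTateModule ℓ))
    (hGu : ((rationalTateModuleMap ℓ u).dualMap).baseChange R' G = (a : ℚ_[ℓ]) • G)
    (hGρ : ∀ r : R, ((rationalTateModuleMap ℓ (End.asHom (ρ r))).dualMap).baseChange R' G = e (algebraMap R M r) • G) :
    ∃ F : R' ⊗[ℚ_[ℓ]] Module.Dual ℚ_[ℓ] ((image u).rationalTateModule ℓ),
      ((rationalTateModuleMap ℓ (toImage u)).dualMap).baseChange R' F = G ∧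
      ∀ m : M, ((rationalTateAction (image u) ℓ (i m)).dualMap).baseChange R' F = e m • F := by
  obtain ⟨F, hF, hFeig⟩ := exists_eq_dualMap_toImage_baseChange_of_mem_eigenspace ℓ u ha R' G hGu
  refine ⟨F, hF, ?_⟩
  -- the integral eigen-relations on the image, through `imageAction = imageRestrict`
  have hFρ : ∀ r : R, ((rationalTateModuleMap ℓ (imageAction u ρ ρ hρ r : image u ⟶ image u)).dualMap).baseChange R' F =
      e (algebraMap R M r) • F := fun r => hFeig (End.asHom (ρ r)) (hρ r) _ (hGρ r)
  exact dualMap_rationalTateAction_baseChange_eq_smul_of_integral (image u) ℓ (imageAction u ρ ρ hρ) i hi R' e F hFρ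

end AbelianVariety

end Literature.AlgebraicGeometry.Motives

end
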